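import Mathlib
import HarnessLib
import Literature.Analysis.FluidPDE.PressureNormalisationL3
import Summits.NavierStokesRegularity.NavierStokesRegularity.Theorems.QuarterLogPincerThinCascadeDefs
import Summits.NavierStokesRegularity.NavierStokesRegularity.Theorems.QuarterLogPincerTypeIQuantSubcubicExpGronwall

/-!
# Crux `QuarterLogPincer.TypeIQuantSubcubicExp` (stmt-NavierStokesRegularity-24077), line `thin_cascade`:
  unit-scale tools — the Type-I weight and the Tao frame (uniform `L²` bound, pressure normalisation)

Helper file (`--supports stmt-NavierStokesRegularity-24077 --as helper`, lead prover ns-tc-p1 g3) toward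
the registered 4th stub `stub_uniformScaledEnergy : UniformScaledEnergy` (skeleton v5); inputs of the
unit-scale clauses `A`, `E`, `D`:

* the Type-I weight `m(t) = |M| (max(T+τ−t, τ))^{-1/2}`: continuous, `≥ 0`, `= |M|(T+τ−t)^{-1/2}` for
  `t ≤ T`, dominating the rate `‖u(t,·)‖ ≤ M (T+τ−t)^{-1/2}`, `≤ |M| τ^{-1/2}`, `m(t₀)² ≤ 2M²` when
  `T − t₀ ≥ 1/2`, and `∫_{t₀}^{t₁} m ≤ 2|M|` on windows of length `≤ 1` inside `[0,T]`
  (`integral_rpow` after the substitution `σ = T+τ−s`);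
* `exists_lintegral_sq_le_of_taoFrame`: the `n = 0` clause of `TaoFrame` as `∫ ‖u(t)‖² ≤ E₀ < ∞`;
* `pressure_normalised_of_taoFrame`: Tao's Lemma 4.1 (i) for a Tao frame under a pointwise bound —
  `p(t) = Π[u(t)] + C(t)` a.e. for `t ∈ (0,T)` (`PressureNormalisationL3`, slices in `L³` uniformly).

HONEST FRAMING: bookkeeping toward one registered stub of an open crux; nothing about Navier–Stokes
regularity is proved; no summit statement is proved by this file.
-/

noncomputable section

-- the summit-side namespace `Summit.NavierStokesRegularity.NavierStokesRegularity.…` (single-conjunct summit,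
-- D-0017) repeats a component by design; the dupNamespace linter would flag every declaration.
set_option linter.dupNamespace false

namespace Summit.NavierStokesRegularity.NavierStokesRegularity.Theorems.ThinCascade

open MeasureTheory Set Function Metric Filter Topology
open scoped ENNReal NNReal ContDiff
open Literature.Analysis Literature.Analysis.FluidPDE Literature.Analysis.FluidPDE.JiaSverak2013
open Summit.NavierStokesRegularity.NavierStokesRegularity.Cruxes.TypeIQuantSubcubicExp.ThinCascade
  (TaoFrame)

/-! ### The Type-I weight -/

/-- **The Type-I weight** `m(t) = |M| (max(T+τ−t, τ))^{-1/2}` is continuous (`τ > 0`). [folklore] -/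
theorem continuous_typeIWeight (M T : ℝ) {τ : ℝ} (hτ : 0 < τ) :
    Continuous fun s : ℝ => |M| * (max (T + τ - s) τ) ^ (-(1 / 2 : ℝ)) := by
  refine continuous_const.mul (Continuous.rpow_const ?_ fun s => Or.inl ?_)
  · exact (continuous_const.sub continuous_id).max continuous_const
  · exact (lt_of_lt_of_le hτ (le_max_right _ _)).ne'

/-- The Type-I weight is nonnegative (`τ > 0`). [folklore] -/
theorem typeIWeight_nonneg (M T : ℝ) {τ : ℝ} (hτ : 0 < τ) (s : ℝ) :
    0 ≤ |M| * (max (T + τ - s) τ) ^ (-(1 / 2 : ℝ)) :=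
  mul_nonneg (abs_nonneg _) (Real.rpow_nonneg (hτ.le.trans (le_max_right _ _)) _)

/-- On `t ≤ T` the weight is `|M| (T+τ−t)^{-1/2}`. [folklore] -/
theorem typeIWeight_eq {M T τ t : ℝ} (ht : t ≤ T) :
    |M| * (max (T + τ - t) τ) ^ (-(1 / 2 : ℝ)) = |M| * (T + τ - t) ^ (-(1 / 2 : ℝ)) := by
  rw [max_eq_left (by linarith)]

/-- The Type-I rate is dominated by the weight: `‖u(t,x)‖ ≤ M (T+τ−t)^{-1/2} ≤ m(t)` for `t ≤ T`.
[folklore] -/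
theorem norm_le_typeIWeight {M T τ t : ℝ} (hτ : 0 < τ) (ht : t ≤ T)
    {v : EuclideanSpace ℝ (Fin 3)} (hv : ‖v‖ ≤ M * (T + τ - t) ^ (-(1 / 2 : ℝ))) :
    ‖v‖ ≤ |M| * (max (T + τ - t) τ) ^ (-(1 / 2 : ℝ)) := by
  rw [typeIWeight_eq ht]
  have h0 : 0 ≤ (T + τ - t) ^ (-(1 / 2 : ℝ)) := Real.rpow_nonneg (by linarith) _
  exact hv.trans (mul_le_mul_of_nonneg_right (le_abs_self M) h0)

/-- The weight is bounded by `|M| τ^{-1/2}`. [folklore] -/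
theorem typeIWeight_le (M T : ℝ) {τ : ℝ} (hτ : 0 < τ) (s : ℝ) :
    |M| * (max (T + τ - s) τ) ^ (-(1 / 2 : ℝ)) ≤ |M| * τ ^ (-(1 / 2 : ℝ)) :=
  mul_le_mul_of_nonneg_left (Real.rpow_le_rpow_of_nonpos hτ (le_max_right _ _) (by norm_num))
    (abs_nonneg _)

/-- At the start of a window inside the last unit of time the squared weight is `≤ 2M²`:
`m(t₀)² ≤ 2 M²` when `T − t₀ ≥ 1/2`. [folklore] -/
theorem typeIWeight_sq_le {M T τ t₀ : ℝ} (hτ : 0 < τ) (ht₀ : t₀ ≤ T - 1 / 2) :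
    (|M| * (max (T + τ - t₀) τ) ^ (-(1 / 2 : ℝ))) ^ 2 ≤ 2 * M ^ 2 := by
  rw [typeIWeight_eq (by linarith)]
  have hpos : 0 < T + τ - t₀ := by linarith
  have e : ((T + τ - t₀) ^ (-(1 / 2 : ℝ))) ^ 2 = (T + τ - t₀)⁻¹ := by
    rw [← Real.rpow_natCast, ← Real.rpow_mul hpos.le]
    norm_num
    rw [Real.rpow_neg_one]
  rw [mul_pow, e, sq_abs]
  have hinv : (T + τ - t₀)⁻¹ ≤ 2 := by
    rw [inv_le_comm₀ hpos (by norm_num)]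
    linarith
  nlinarith [sq_nonneg M]

/-- **The weight is integrable with mass `≤ 2|M|` on windows of length `≤ 1` ending before `T`:**
`∫_{t₀}^{t₁} |M| (T+τ−s)^{-1/2} ds = 2|M| (√(T+τ−t₀) − √(T+τ−t₁)) ≤ 2|M|`. [folklore] -/
theorem integral_typeIWeight_le {M T τ t₀ t₁ : ℝ} (hτ : 0 < τ) (h₀ : T - 1 ≤ t₀) (h₀₁ : t₀ ≤ t₁)
    (h₁ : t₁ ≤ T) :
    ∫ s in t₀..t₁, |M| * (max (T + τ - s) τ) ^ (-(1 / 2 : ℝ)) ≤ 2 * |M| := by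
  have hcongr : ∫ s in t₀..t₁, |M| * (max (T + τ - s) τ) ^ (-(1 / 2 : ℝ)) =
      ∫ s in t₀..t₁, |M| * (T + τ - s) ^ (-(1 / 2 : ℝ)) := by
    refine intervalIntegral.integral_congr fun s hs => ?_
    rw [uIcc_of_le h₀₁] at hs
    exact typeIWeight_eq (hs.2.trans h₁)
  rw [hcongr, intervalIntegral.integral_const_mul]
  have hsub : ∫ s in t₀..t₁, (T + τ - s) ^ (-(1 / 2 : ℝ)) =
      ∫ σ in (T + τ - t₁)..(T + τ - t₀), σ ^ (-(1 / 2 : ℝ)) := by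
    rw [← intervalIntegral.integral_comp_sub_left (fun σ => σ ^ (-(1 / 2 : ℝ))) (T + τ)]
  rw [hsub, integral_rpow (Or.inl (by norm_num))]
  have ha : 0 < T + τ - t₁ := by linarith
  have hb : 0 < T + τ - t₀ := by linarith
  rw [show (-(1 / 2 : ℝ) + 1) = 1 / 2 by norm_num, ← Real.sqrt_eq_rpow, ← Real.sqrt_eq_rpow]
  -- `√b − √a ≤ 1` since `b ≤ a + 1`
  have hsq : Real.sqrt (T + τ - t₀) ≤ Real.sqrt (T + τ - t₁) + 1 := by
    calc Real.sqrt (T + τ - t₀) ≤ Real.sqrt ((Real.sqrt (T + τ - t₁) + 1) ^ 2) := by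
          refine Real.sqrt_le_sqrt ?_
          nlinarith [Real.sq_sqrt ha.le, Real.sqrt_nonneg (T + τ - t₁)]
      _ = Real.sqrt (T + τ - t₁) + 1 := Real.sqrt_sq (by positivity)
  have hM0 : 0 ≤ |M| := abs_nonneg M
  have : (Real.sqrt (T + τ - t₀) - Real.sqrt (T + τ - t₁)) / (1 / 2) ≤ 2 := by
    rw [div_le_iff₀ (by norm_num)]
    linarith
  calc |M| * ((Real.sqrt (T + τ - t₀) - Real.sqrt (T + τ - t₁)) / (1 / 2)) ≤ |M| * 2 :=
      mul_le_mul_of_nonneg_left this hM0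
    _ = 2 * |M| := mul_comm _ _

/-! ### The Tao frame: uniform `L²` bound, `L³` slices, pressure normalisation -/

/-- **The uniform `L²` bound of a Tao frame** in `ℝ≥0∞` form: `∫ ‖u(t)‖² ≤ C₀²` on `[0,T]`
(the `n = 0` clause of `TaoFrame`). [folklore] -/
theorem exists_lintegral_sq_le_of_taoFrame {T : ℝ}
    {u : ℝ → EuclideanSpace ℝ (Fin 3) → EuclideanSpace ℝ (Fin 3)} {p : ℝ → EuclideanSpace ℝ (Fin 3) → ℝ}
    (hfr : TaoFrame T u p) :
    ∃ E₀ : ℝ≥0∞, E₀ ≠ ⊤ ∧ ∀ t ∈ Icc 0 T, ∫⁻ x, ‖u t x‖ₑ ^ 2 ≤ E₀ := by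
  obtain ⟨C₀, hC₀⟩ := hfr.2 0
  refine ⟨(C₀ : ℝ≥0∞) ^ 2, ENNReal.pow_ne_top ENNReal.coe_ne_top, fun t ht => ?_⟩
  have h1 : eLpNorm (u t) 2 volume ≤ C₀ := by
    have e : eLpNorm (iteratedFDeriv ℝ 0 (u t)) 2 volume = eLpNorm (u t) 2 volume :=
      eLpNorm_congr_norm_ae (Eventually.of_forall fun x => norm_iteratedFDeriv_zero)
    rw [← e]
    exact hC₀ t ht
  have e2 : ∫⁻ x, ‖u t x‖ₑ ^ 2 = eLpNorm (u t) 2 volume ^ 2 := by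
    rw [eLpNorm_eq_lintegral_rpow_enorm_toReal two_ne_zero ENNReal.ofNat_ne_top, ENNReal.toReal_ofNat,
      ← ENNReal.rpow_natCast, ← ENNReal.rpow_mul, show (1 / (2 : ℝ) * ((2 : ℕ) : ℝ)) = 1 by norm_num,
      ENNReal.rpow_one]
    exact lintegral_congr fun x => by
      rw [show (2 : ℝ) = ((2 : ℕ) : ℝ) by norm_num, ENNReal.rpow_natCast]
  rw [e2]
  exact pow_le_pow_left' h1 2

/-- **Tao's pressure normalisation for a Tao frame under a pointwise bound**: on the open interval
`(0, T)` the pressure is the whole-space pressure up to a constant, `p(t) = Π[u(t)] + C(t)` a.e.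
(`PressureNormalisationL3.pressure_ae_eq_rieszPressure_add_const`; the slices are in `L³` with a
uniform bound because they are uniformly in `L²` and uniformly bounded).
[cite: Tao2011, Lemma 4.1 (i)] -/
theorem pressure_normalised_of_taoFrame {T m : ℝ}
    {u : ℝ → EuclideanSpace ℝ (Fin 3) → EuclideanSpace ℝ (Fin 3)} {p : ℝ → EuclideanSpace ℝ (Fin 3) → ℝ}
    (hfr : TaoFrame T u p) (hum : ∀ t ∈ Icc 0 T, ∀ x, ‖u t x‖ ≤ m) :
    ∀ t ∈ Ioo 0 T, ∃ C : ℝ, ∀ᵐ x ∂(volume : Measure (EuclideanSpace ℝ (Fin 3))),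
      p t x = rieszPressure (u t) x + C := by
  obtain ⟨E₀, hE₀, hE⟩ := exists_lintegral_sq_le_of_taoFrame hfr
  have hcl : IsClassicalNSSolutionOn (Ioo 0 T) 1 0 u p :=
    hfr.1.mono Ioo_subset_Icc_self (uniqueDiffOn_Ioo 0 T)
  have hm0 : ∀ t ∈ Ioo 0 T, 0 ≤ m := fun t ht => (norm_nonneg _).trans (hum t (Ioo_subset_Icc_self ht) 0)
  have h2 : ∀ t ∈ Ioo 0 T, MemLp (u t) 2 volume := fun t ht =>
    memLp_two_of_lintegral_ne_top (hcl.contDiff_velocity ht).continuous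
      (ne_top_of_le_ne_top hE₀ (hE t (Ioo_subset_Icc_self ht)))
  have h3 : ∀ t ∈ Ioo 0 T, MemLp (u t) 3 volume := fun t ht =>
    memLp_three_of_memLp_two_of_norm_le (h2 t ht) (hum t (Ioo_subset_Icc_self ht))
  -- a uniform `L³` bound
  set M₃ : ℝ≥0 := ((ENNReal.ofReal m * E₀) ^ (1 / 3 : ℝ)).toNNReal with hM₃
  have hM₃top : (ENNReal.ofReal m * E₀) ^ (1 / 3 : ℝ) ≠ ⊤ :=
    ENNReal.rpow_ne_top_of_nonneg (by norm_num) (ENNReal.mul_ne_top ENNReal.ofReal_ne_top hE₀)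
  have hM₃coe : (M₃ : ℝ≥0∞) = (ENNReal.ofReal m * E₀) ^ (1 / 3 : ℝ) := ENNReal.coe_toNNReal hM₃top
  have hM : ∀ t ∈ Ioo 0 T, eLpNorm (u t) 3 volume ≤ M₃ := by
    intro t ht
    rw [hM₃coe, eLpNorm_eq_lintegral_rpow_enorm_toReal (by norm_num) (by norm_num), ENNReal.toReal_ofNat]
    refine ENNReal.rpow_le_rpow ?_ (by norm_num)
    have hcube : ∫⁻ x, ‖u t x‖ₑ ^ (3 : ℝ) = ∫⁻ x in univ, ‖u t x‖ₑ ^ (3 : ℕ) := by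
      rw [Measure.restrict_univ]
      exact lintegral_congr fun x => by
        rw [show (3 : ℝ) = ((3 : ℕ) : ℝ) by norm_num, ENNReal.rpow_natCast]
    rw [hcube]
    calc ∫⁻ x in univ, ‖u t x‖ₑ ^ (3 : ℕ)
        ≤ ENNReal.ofReal m * ∫⁻ x in univ, ‖u t x‖ₑ ^ 2 :=
          lintegral_cube_le_mul_sq (hum t (Ioo_subset_Icc_self ht)) univ
      _ ≤ ENNReal.ofReal m * E₀ := by
          rw [Measure.restrict_univ]
          exact mul_le_mul' le_rfl (hE t (Ioo_subset_Icc_self ht))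
  intro t ht
  exact PressureNormalisationL3.pressure_ae_eq_rieszPressure_add_const zero_le_one hcl h3 hM ht

end Summit.NavierStokesRegularity.NavierStokesRegularity.Theorems.ThinCascade

end
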